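import Summits.NavierStokesRegularity.NavierStokesRegularity.Theses.AxisymmetricExtremality
import Summits.NavierStokesRegularity.NavierStokesRegularity.Theorems.AxisymmetricExtremalityAxisymmetricKatoGlobalNoSwirlStratum
import Literature.Analysis.FluidPDE.AxisymmetricEuler
import Literature.Analysis.FluidPDE.KatoMaximalTime
import Literature.Analysis.FluidPDE.AxisymmetricTypeIBounded
import HarnessLib.Audit

/-!
# Strategist sketch s17-g2 for the crux `AxisymmetricExtremality.AxisymmetricKatoGlobal`
(item `stmt-NavierStokesRegularity-15453`; second, independent strategy census, family `-s`, gen 2).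

Typed versions of the census attempts (all `def`s are `Prop`s over existing declarations; the
theorems are the trivial logical relations the census relies on; no `sorry`).

* §W  `NoAxisymMinimalBlowupDatum` — the threshold instance that `closes` actually consumes, with
  `closes_of_noAxisymMinimal` (the route's deciding theorem goes through verbatim with it) and
  `noAxisymMinimal_of_crux` (it is formally weaker than the crux).
* §D1 `SwirlStratum` — the crux minus its proved swirl-free stratum; `crux_of_swirlStratum`.
* §D3 `AprioriAxisModulus φ` / `ModulusCriterion φ` — the rate-family cut (a-priori modulus of the
  swirl at the axis × regularity criterion at that modulus).
* §S  `AprioriAxisModulusLog3` — the strengthening S⁺ (= registered stub 3's a-priori estimate).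
* §T  `AprioriOneSidedInflow` — the transfer/regime piece suggested by Q. S. Zhang 2026
  (partial Type I, arXiv:2604.07785): an a-priori one-sided radial-inflow bound.
-/

noncomputable section

open Set MeasureTheory Function Metric
open scoped ENNReal NNReal
open Literature.Analysis.FluidPDE Literature.Analysis.FunctionSpaces
open Summit.NavierStokesRegularity.NavierStokesRegularity.Theses.AxisymmetricExtremality

namespace Summit.NavierStokesRegularity.NavierStokesRegularity.Cruxes.AxisymmetricKatoGlobal.StrategistS17g2

set_option linter.unusedVariables false
set_option linter.dupNamespace false

/-- `ℝ³` as a Euclidean space (abbreviation, no notation). -/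
abbrev R3 : Type := EuclideanSpace ℝ (Fin 3)
/-- `ℂ³`. -/
abbrev C3 : Type := EuclideanSpace ℂ (Fin 3)

/-! ## §W — the weaker, summit-side intermediate actually consumed by `closes` -/

/-- W0. No axisymmetric Rusin–Šverák minimal blow-up datum, for any viscosity. This is the ONLY
instance of the crux that the route's `closes` uses (`h₃` is applied to the datum produced by
`PFoldToAxisymmetric`). -/
def NoAxisymMinimalBlowupDatum : Prop :=
  ∀ ν : ℝ, 0 < ν → ¬ ∃ (u₀ : R3 → R3) (g : HomSobolev R3 C3 (1 / 2 : ℝ)),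
    IsMinimalBlowupDatum ν u₀ g ∧ IsAxisymmetric u₀

/-- The crux implies W0 (W0 is formally weaker). -/
theorem noAxisymMinimal_of_crux (h : AxisymmetricKatoGlobal) : NoAxisymMinimalBlowupDatum := by
  intro ν hν ⟨u₀, g, hmin, hax⟩
  obtain ⟨hL3, hrep, hdiv, -, hnot⟩ := hmin
  exact hnot (h ν hν u₀ g hL3 hrep hdiv (fun θ x => hax θ x))

/-- The route's deciding theorem goes through with W0 in place of the crux (same proof as
`Theses.AxisymmetricExtremality.closes`). -/
theorem closes_of_noAxisymMinimal (h₂ : MinimalDatumPFold) (h₄ : PFoldToAxisymmetric)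
    (h₃ : NoAxisymMinimalBlowupDatum) : NavierStokesRegularity := by
  show Literature.NS.NavierStokesExistenceSmoothR3
  intro ν hν u₀ hsm hdiv hdec
  by_contra hno
  obtain ⟨u₁, g, hmin, hax⟩ := h₄ ν hν (h₂ ν hν ⟨u₀, hsm, hdiv, hdec, hno⟩)
  exact h₃ ν hν ⟨u₁, g, hmin, fun θ x => hax θ x⟩

/-! ## §D1 — swirl / no-swirl strata -/

/-- D1. The crux restricted to data WITH swirl (`¬ HasNoSwirl u₀`). -/
def SwirlStratum : Prop :=
  ∀ ν : ℝ, 0 < ν → ∀ (u₀ : R3 → R3) (g : HomSobolev R3 C3 (1 / 2 : ℝ)),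
    MemLp u₀ 3 volume → g.Represents (Literature.Analysis.FunctionSpaces.EuclideanSpace.complexify ∘ u₀) →
    IsWeaklyDivFree u₀ → IsAxisymmetric u₀ → ¬ HasNoSwirl u₀ → HasGlobalKatoSolution ν u₀

/-- The proved swirl-free stratum (`axisymmetricKatoGlobal_noSwirl_stratum`, landed) removes
nothing: the crux is equivalent to its swirl stratum. -/
theorem crux_of_swirlStratum (h : SwirlStratum) : AxisymmetricKatoGlobal := by
  intro ν hν u₀ g hL3 hrep hdiv hax
  by_cases hsw : HasNoSwirl u₀
  · exact Theorems.AxisymmetricKatoGlobal.NoSwirlStratum.axisymmetricKatoGlobal_noSwirl_stratum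
      ν hν u₀ hL3 hdiv hax hsw
  · exact h ν hν u₀ g hL3 hrep hdiv (fun θ x => hax θ x) hsw

theorem swirlStratum_of_crux (h : AxisymmetricKatoGlobal) : SwirlStratum :=
  fun ν hν u₀ g hL3 hrep hdiv hax _ => h ν hν u₀ g hL3 hrep hdiv (fun θ x => hax θ x)

/-! ## §D3 — the rate-family cut: a-priori axis modulus × criterion at that modulus -/

/-- D3(a). A-PRIORI MODULUS at rate `φ`: every smooth axisymmetric Kato solution on `[0,T)` has,
on each `[t₀,T)`, the modulus `|Γ(t,x)| ≤ C φ(r)` at the axis (`r = cylRadius x ≤ δ₀`), with `C, δ₀`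
independent of `t < T`.  Known only for `φ ≡ 1` (local maximum principle for `Γ`). -/
def AprioriAxisModulus (φ : ℝ → ℝ) : Prop :=
  ∀ ν : ℝ, 0 < ν → ∀ T : ℝ, 0 < T → ∀ (u₀ : R3 → R3) (u : ℝ → R3 → R3),
    MemLp u₀ 3 volume → IsKatoSolutionOn T ν u₀ u →
    ContDiffOn ℝ (⊤ : ℕ∞) (uncurry u) (Ioo 0 T ×ˢ univ) → (∀ t ∈ Ioo 0 T, IsAxisymmetric (u t)) →
    ∀ t₀ ∈ Ioo 0 T, ∃ C δ₀ : ℝ, 0 < δ₀ ∧ δ₀ < 1 ∧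
      ∀ t ∈ Ico t₀ T, ∀ x : R3, cylRadius x ≤ δ₀ → |swirl (u t) x| ≤ C * φ (cylRadius x)

/-- D3(b). CRITERION at rate `φ`: that modulus forces local boundedness at every point up to `T`
(hence continuation).  Known for `φ r = |log r|⁻²` (Lei–Zhang 2017), `|log r|^{-3/2}` (Wei 2016),
and the local `|log r|⁻³` form (Seregin 2022, in-tree composition `logSwirlRegularity`); OPEN for
`φ ≡ ε` small and for `φ ≡ 1`. -/
def ModulusCriterion (φ : ℝ → ℝ) : Prop :=
  ∀ ν : ℝ, 0 < ν → ∀ T : ℝ, 0 < T → ∀ (u₀ : R3 → R3) (u : ℝ → R3 → R3),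
    MemLp u₀ 3 volume → IsKatoSolutionOn T ν u₀ u →
    ContDiffOn ℝ (⊤ : ℕ∞) (uncurry u) (Ioo 0 T ×ˢ univ) → (∀ t ∈ Ioo 0 T, IsAxisymmetric (u t)) →
    (∀ t₀ ∈ Ioo 0 T, ∃ C δ₀ : ℝ, 0 < δ₀ ∧ δ₀ < 1 ∧
      ∀ t ∈ Ico t₀ T, ∀ x : R3, cylRadius x ≤ δ₀ → |swirl (u t) x| ≤ C * φ (cylRadius x)) →
    ∀ x₀ : R3, IsBoundedNearTop u T x₀

/-- The two halves compose to "every smooth axisymmetric Kato solution is bounded near every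
point of its final time" — the input of registered stub 1 (singular point) / Kato continuation. -/
theorem boundedNearTop_of_cut (φ : ℝ → ℝ) (ha : AprioriAxisModulus φ) (hc : ModulusCriterion φ) :
    ∀ ν : ℝ, 0 < ν → ∀ T : ℝ, 0 < T → ∀ (u₀ : R3 → R3) (u : ℝ → R3 → R3),
      MemLp u₀ 3 volume → IsKatoSolutionOn T ν u₀ u →
      ContDiffOn ℝ (⊤ : ℕ∞) (uncurry u) (Ioo 0 T ×ˢ univ) → (∀ t ∈ Ioo 0 T, IsAxisymmetric (u t)) →
      ∀ x₀ : R3, IsBoundedNearTop u T x₀ :=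
  fun ν hν T hT u₀ u hL3 hK hsm hax =>
    hc ν hν T hT u₀ u hL3 hK hsm hax (ha ν hν T hT u₀ u hL3 hK hsm hax)

/-! ## §S — the strengthening S⁺ -/

/-- S⁺. The a-priori `|log r|⁻³` modulus (registered stub 3 without the `Ḣ^{1/2}` hypothesis):
strictly stronger than what the crux needs, and the only typed strengthening with a criterion
waiting for it. -/
def AprioriAxisModulusLog3 : Prop :=
  AprioriAxisModulus (fun r => 1 / |Real.log r| ^ 3)

/-! ## §T — transfer / regime piece (partial Type I, Q. S. Zhang 2026) -/

/-- T. A-PRIORI ONE-SIDED INFLOW BOUND: the radial velocity of a smooth axisymmetric Kato solution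
satisfies `u_r(t,x) ≥ -c/√(T-t)` on `(0,T)`.  With it, arXiv:2604.07785 Thm 1.1 gives regularity
(for `H²`-type data with bounded `Γ₀`); without it nothing is known.  It is a one-sided TYPE-I
statement, so a genuinely Type-II singularity violates it: as an a-priori claim it is as open as
the crux. -/
def AprioriOneSidedInflow : Prop :=
  ∀ ν : ℝ, 0 < ν → ∀ T : ℝ, 0 < T → ∀ (u₀ : R3 → R3) (u : ℝ → R3 → R3),
    MemLp u₀ 3 volume → IsKatoSolutionOn T ν u₀ u →
    ContDiffOn ℝ (⊤ : ℕ∞) (uncurry u) (Ioo 0 T ×ˢ univ) → (∀ t ∈ Ioo 0 T, IsAxisymmetric (u t)) →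
    ∀ t₀ ∈ Ioo 0 T, ∃ c : ℝ, ∀ t ∈ Ico t₀ T, ∀ x : R3,
      -c / Real.sqrt (T - t) ≤ radialVelocity (u t) x

end Summit.NavierStokesRegularity.NavierStokesRegularity.Cruxes.AxisymmetricKatoGlobal.StrategistS17g2

end
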